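import Summits.CriticalPhenomena.PercolationContinuityZ3.Theorems.PercNearOneGluingNoHeavyLowerTailSahiOneStepFibreF3Reduce
import Mathlib.Data.Finset.Card
import Mathlib.Data.Fintype.Card
import Mathlib.Order.Interval.Finset.Nat
import Mathlib.Data.Real.Basic
import HarnessLib

/-!
# One-step scheme: TRANSPORT of the three-copy fibre form along a relabelling of the free coordinates

Support file (prover prim-ineq-prove-3 gen 16; `--supports stmt-CriticalPhenomena-4575`; memo
`run/shared/lean/prim/prim-ineq-prove-3/FINDING-G16-FIBRE-MAJ5.md` §3.8).  No definitions, no named facts, no sorries, no `native_decide`.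

For a map `β : ι → ℕ` injective on `D₁ ∪ D₂`, the fibre form `f3sum` (`…FibreF3Defs`) of `(D₁, D₂)` at functions pulled back along `Finset.image β`
equals the fibre form of `(D₁.image β, D₂.image β)` (`f3sum_image`); a relabelling `β` with `D₁.image β = range |D₁|`, `D₂.image β = Ico |D₁| (|D₁|+|D₂|)`
exists (`exists_relabel`); and upper families of `P(D₁ ∪ D₂)` push forward to upper families of `P(range (|D₁|+|D₂|))` (`f3sum_indicator_eq_image`).
This moves the nonnegativity of the forms on pairs of upper families from `ℕ` (where it is decided by computation) to an arbitrary index type.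
-/

noncomputable section

namespace Summit.CriticalPhenomena.PercolationContinuityZ3.Theorems

namespace SahiOneStep

open Finset

variable {ι : Type*} [DecidableEq ι]

/-! ## Images and preimages of sub-finsets under a map injective on `D` -/

omit [DecidableEq ι] in
/-- Preimage inside `D`. -/
theorem filter_mem_image_eq {β : ι → ℕ} {D X : Finset ι} (hinj : ∀ a ∈ D, ∀ b ∈ D, β a = β b → a = b) (hX : X ⊆ D) :
    D.filter (fun a => β a ∈ X.image β) = X := by
  ext a
  simp only [Finset.mem_filter, Finset.mem_image]
  constructor
  · rintro ⟨haD, b, hbX, hba⟩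
    rwa [← hinj b (hX hbX) a haD hba]
  · intro haX
    exact ⟨hX haX, a, haX, rfl⟩

omit [DecidableEq ι] in
/-- Image of a preimage inside `D`. -/
theorem image_filter_mem_eq {β : ι → ℕ} {D : Finset ι} {X' : Finset ℕ} (hX' : X' ⊆ D.image β) :
    (D.filter (fun a => β a ∈ X')).image β = X' := by
  ext c
  simp only [Finset.mem_image, Finset.mem_filter]
  constructor
  · rintro ⟨a, ⟨_, haX⟩, rfl⟩; exact haX
  · intro hc
    obtain ⟨a, haD, rfl⟩ := Finset.mem_image.1 (hX' hc)
    exact ⟨a, ⟨haD, hc⟩, rfl⟩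

omit [DecidableEq ι] in
/-- Images of disjoint subsets of `D` are disjoint. -/
theorem disjoint_image_of_injOn {β : ι → ℕ} {D X Y : Finset ι} (hinj : ∀ a ∈ D, ∀ b ∈ D, β a = β b → a = b) (hX : X ⊆ D) (hY : Y ⊆ D)
    (h : Disjoint X Y) : Disjoint (X.image β) (Y.image β) := by
  rw [Finset.disjoint_left]
  intro c hcX hcY
  obtain ⟨a, haX, rfl⟩ := Finset.mem_image.1 hcX
  obtain ⟨b, hbY, hba⟩ := Finset.mem_image.1 hcY
  have := hinj b (hY hbY) a (hX haX) hba
  subst this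
  exact Finset.disjoint_left.1 h haX hbY

/-- Image of a difference inside `D`. -/
theorem image_sdiff_of_injOn' {β : ι → ℕ} {D X Y : Finset ι} (hinj : ∀ a ∈ D, ∀ b ∈ D, β a = β b → a = b) (hX : X ⊆ D) (hY : Y ⊆ D) :
    (X \ Y).image β = X.image β \ Y.image β := by
  ext c
  simp only [Finset.mem_image, Finset.mem_sdiff]
  constructor
  · rintro ⟨a, ⟨haX, haY⟩, rfl⟩
    refine ⟨⟨a, haX, rfl⟩, ?_⟩
    rintro ⟨b, hbY, hba⟩
    exact haY (hinj b (hY hbY) a (hX haX) hba ▸ hbY)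
  · rintro ⟨⟨a, haX, rfl⟩, hnot⟩
    exact ⟨a, ⟨haX, fun haY => hnot ⟨a, haY, rfl⟩⟩, rfl⟩

omit [DecidableEq ι] in
/-- Cardinality of an image of a subset of `D`. -/
theorem card_image_of_injOn' {β : ι → ℕ} {D X : Finset ι} (hinj : ∀ a ∈ D, ∀ b ∈ D, β a = β b → a = b) (hX : X ⊆ D) :
    (X.image β).card = X.card :=
  Finset.card_image_of_injOn fun a ha b hb h => hinj a (hX ha) b (hX hb) h

/-! ## Transport of the fibre form -/

omit [DecidableEq ι] in
/-- Members of `f3quads` (restated from the defs). -/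
theorem mem_f3quads' {κ : Type*} [DecidableEq κ] {D₁ D₂ : Finset κ} {q : (Finset κ × Finset κ) × (Finset κ × Finset κ)} :
    q ∈ f3quads D₁ D₂ ↔ (q.1.1 ⊆ D₁ ∧ q.1.2 ⊆ D₁) ∧ (q.2.1 ⊆ D₂ ∧ q.2.2 ⊆ D₂) ∧ Disjoint q.1.1 q.1.2 ∧ Disjoint q.2.1 q.2.2 := by
  simp only [f3quads, Finset.mem_filter, Finset.mem_product, Finset.mem_powerset, and_assoc]

/-- **Transport**: the fibre form at functions pulled back along `image β` is the fibre form of the image coordinate sets. [this work] -/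
theorem f3sum_image {R : Type*} [CommRing R] (β : ι → ℕ) {D₁ D₂ : Finset ι} (hinj : ∀ a ∈ D₁ ∪ D₂, ∀ b ∈ D₁ ∪ D₂, β a = β b → a = b)
    (θ : ℕ) (u v : Finset ℕ → R) :
    f3sum R D₁ D₂ θ (fun S => u (S.image β)) (fun S => v (S.image β)) = f3sum R (D₁.image β) (D₂.image β) θ u v := by
  have h1D : D₁ ⊆ D₁ ∪ D₂ := Finset.subset_union_left
  have h2D : D₂ ⊆ D₁ ∪ D₂ := Finset.subset_union_right
  have hinj1 : ∀ a ∈ D₁, ∀ b ∈ D₁, β a = β b → a = b := fun a ha b hb => hinj a (h1D ha) b (h1D hb)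
  have hinj2 : ∀ a ∈ D₂, ∀ b ∈ D₂, β a = β b → a = b := fun a ha b hb => hinj a (h2D ha) b (h2D hb)
  unfold f3sum
  refine Finset.sum_nbij' (fun q => ((q.1.1.image β, q.1.2.image β), (q.2.1.image β, q.2.2.image β)))
    (fun q' => (((D₁.filter fun a => β a ∈ q'.1.1), (D₁.filter fun a => β a ∈ q'.1.2)),
      ((D₂.filter fun a => β a ∈ q'.2.1), (D₂.filter fun a => β a ∈ q'.2.2))))
    (fun q hq => ?_) (fun q' hq' => ?_) (fun q hq => ?_) (fun q' hq' => ?_) (fun q hq => ?_)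
  · -- maps into the image quadruples
    obtain ⟨⟨h11, h12⟩, ⟨h21, h22⟩, hd1, hd2⟩ := mem_f3quads'.1 hq
    exact mem_f3quads'.2 ⟨⟨Finset.image_subset_image h11, Finset.image_subset_image h12⟩,
      ⟨Finset.image_subset_image h21, Finset.image_subset_image h22⟩, disjoint_image_of_injOn hinj1 h11 h12 hd1,
      disjoint_image_of_injOn hinj2 h21 h22 hd2⟩
  · -- the inverse maps back
    obtain ⟨⟨_, _⟩, ⟨_, _⟩, hd1, hd2⟩ := mem_f3quads'.1 hq'
    refine mem_f3quads'.2 ⟨⟨Finset.filter_subset _ _, Finset.filter_subset _ _⟩, ⟨Finset.filter_subset _ _, Finset.filter_subset _ _⟩, ?_, ?_⟩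
    · exact Finset.disjoint_left.2 fun a ha hb => Finset.disjoint_left.1 hd1 (Finset.mem_filter.1 ha).2 (Finset.mem_filter.1 hb).2
    · exact Finset.disjoint_left.2 fun a ha hb => Finset.disjoint_left.1 hd2 (Finset.mem_filter.1 ha).2 (Finset.mem_filter.1 hb).2
  · -- left inverse
    obtain ⟨⟨h11, h12⟩, ⟨h21, h22⟩, -, -⟩ := mem_f3quads'.1 hq
    simp only [filter_mem_image_eq hinj1 h11, filter_mem_image_eq hinj1 h12, filter_mem_image_eq hinj2 h21,
      filter_mem_image_eq hinj2 h22]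
  · -- right inverse
    obtain ⟨⟨h11, h12⟩, ⟨h21, h22⟩, -, -⟩ := mem_f3quads'.1 hq'
    simp only [image_filter_mem_eq h11, image_filter_mem_eq h12, image_filter_mem_eq h21, image_filter_mem_eq h22]
  · -- the summand
    obtain ⟨⟨h11, h12⟩, ⟨h21, h22⟩, -, -⟩ := mem_f3quads'.1 hq
    have hS0 : (f3S0 D₂ q).image β = f3S0 (D₂.image β) ((q.1.1.image β, q.1.2.image β), (q.2.1.image β, q.2.2.image β)) := by
      simp only [f3S0, Finset.image_union, image_sdiff_of_injOn' hinj2 (subset_refl _) h21]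
    have hS1 : (f3S1 D₂ q).image β = f3S1 (D₂.image β) ((q.1.1.image β, q.1.2.image β), (q.2.1.image β, q.2.2.image β)) := by
      simp only [f3S1, Finset.image_union, image_sdiff_of_injOn' hinj2 (subset_refl _) h22]
    have hS2 : (f3S2 D₁ q).image β = f3S2 (D₁.image β) ((q.1.1.image β, q.1.2.image β), (q.2.1.image β, q.2.2.image β)) := by
      simp only [f3S2, Finset.image_union, image_sdiff_of_injOn' hinj1 (subset_refl _) (Finset.union_subset h11 h12)]
    have hsub0 : f3S0 D₂ q ⊆ D₁ ∪ D₂ := by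
      intro i hi; simp only [f3S0, Finset.mem_union, Finset.mem_sdiff] at hi
      rcases hi with ⟨h, _⟩ | h
      · exact h2D h
      · exact h1D (h11 h)
    have hsub1 : f3S1 D₂ q ⊆ D₁ ∪ D₂ := by
      intro i hi; simp only [f3S1, Finset.mem_union, Finset.mem_sdiff] at hi
      rcases hi with ⟨h, _⟩ | h
      · exact h2D h
      · exact h1D (h12 h)
    have hsub2 : f3S2 D₁ q ⊆ D₁ ∪ D₂ := by
      intro i hi; simp only [f3S2, Finset.mem_union, Finset.mem_sdiff] at hi
      rcases hi with (h | h) | ⟨h, _⟩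
      · exact h2D (h21 h)
      · exact h2D (h22 h)
      · exact h1D h
    have hthr : ∀ S : Finset ι, S ⊆ D₁ ∪ D₂ → thrR R θ S = thrR R θ (S.image β) := fun S hS => by
      unfold thrR; rw [card_image_of_injOn' hinj hS]
    simp only [f3term]
    rw [hthr _ hsub0, hthr _ hsub1, hthr _ hsub2, hS0, hS1, hS2]

/-! ## A relabelling of `D₁ ⊔ D₂` onto `range d1 ⊔ Ico d1 (d1+d2)` -/

/-- **Existence of a relabelling.** [folklore] -/
theorem exists_relabel (D₁ D₂ : Finset ι) (hdisj : Disjoint D₁ D₂) :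
    ∃ β : ι → ℕ, (∀ a ∈ D₁ ∪ D₂, ∀ b ∈ D₁ ∪ D₂, β a = β b → a = b) ∧ D₁.image β = Finset.range D₁.card ∧
      D₂.image β = Finset.Ico D₁.card (D₁.card + D₂.card) := by
  classical
  let e₁ := D₁.equivFin
  let e₂ := D₂.equivFin
  let β : ι → ℕ := fun i => if h : i ∈ D₁ then (e₁ ⟨i, h⟩ : ℕ) else if h' : i ∈ D₂ then D₁.card + (e₂ ⟨i, h'⟩ : ℕ) else 0
  have hβ1 : ∀ i (h : i ∈ D₁), β i = (e₁ ⟨i, h⟩ : ℕ) := fun i h => by simp only [β, dif_pos h]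
  have hβ2 : ∀ i (h : i ∈ D₂), β i = D₁.card + (e₂ ⟨i, h⟩ : ℕ) := fun i h => by
    have h1 : i ∉ D₁ := fun h1 => Finset.disjoint_left.1 hdisj h1 h
    simp only [β, dif_neg h1, dif_pos h]
  refine ⟨β, fun a ha b hb hab => ?_, ?_, ?_⟩
  · rcases Finset.mem_union.1 ha with ha | ha <;> rcases Finset.mem_union.1 hb with hb | hb
    · rw [hβ1 a ha, hβ1 b hb] at hab
      have := e₁.injective (Fin.ext hab)
      exact Subtype.ext_iff.1 this
    · rw [hβ1 a ha, hβ2 b hb] at hab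
      have := (e₁ ⟨a, ha⟩).isLt; omega
    · rw [hβ2 a ha, hβ1 b hb] at hab
      have := (e₁ ⟨b, hb⟩).isLt; omega
    · rw [hβ2 a ha, hβ2 b hb] at hab
      have hv : (e₂ ⟨a, ha⟩ : ℕ) = (e₂ ⟨b, hb⟩ : ℕ) := by omega
      have := e₂.injective (Fin.ext hv)
      exact Subtype.ext_iff.1 this
  · ext k
    simp only [Finset.mem_image, Finset.mem_range]
    constructor
    · rintro ⟨i, hi, rfl⟩; rw [hβ1 i hi]; exact (e₁ ⟨i, hi⟩).isLt
    · intro hk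
      refine ⟨(e₁.symm ⟨k, hk⟩ : D₁), (e₁.symm ⟨k, hk⟩).2, ?_⟩
      rw [hβ1 _ (e₁.symm ⟨k, hk⟩).2]
      simp
  · ext k
    simp only [Finset.mem_image, Finset.mem_Ico]
    constructor
    · rintro ⟨i, hi, rfl⟩; rw [hβ2 i hi]; have := (e₂ ⟨i, hi⟩).isLt; omega
    · rintro ⟨hk1, hk2⟩
      have hk : k - D₁.card < D₂.card := by omega
      refine ⟨(e₂.symm ⟨k - D₁.card, hk⟩ : D₂), (e₂.symm ⟨_, hk⟩).2, ?_⟩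
      rw [hβ2 _ (e₂.symm ⟨_, hk⟩).2]
      simp only [Subtype.coe_eta, Equiv.apply_symm_apply]
      omega

/-! ## Upper families push forward -/

/-- **Nonnegativity on pairs of upper families transports** from `(range d1, Ico d1 (d1+d2))` to any disjoint `(D₁, D₂)` with `|D₁| = d1`,
`|D₂| = d2`. [this work] -/
theorem f3sum_upper_nonneg_of_nat (D₁ D₂ : Finset ι) (hdisj : Disjoint D₁ D₂) (θ : ℕ)
    (hnat : ∀ U' V' : Finset (Finset ℕ), U' ⊆ (Finset.range (D₁.card + D₂.card)).powerset →
      (∀ S ∈ U', ∀ T ∈ (Finset.range (D₁.card + D₂.card)).powerset, S ⊆ T → T ∈ U') →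
      V' ⊆ (Finset.range (D₁.card + D₂.card)).powerset →
      (∀ S ∈ V', ∀ T ∈ (Finset.range (D₁.card + D₂.card)).powerset, S ⊆ T → T ∈ V') →
      (0 : ℝ) ≤ f3sum ℝ (Finset.range D₁.card) (Finset.Ico D₁.card (D₁.card + D₂.card)) θ
        (fun S => if S ∈ U' then 1 else 0) (fun S => if S ∈ V' then 1 else 0))
    (U V : Finset (Finset ι)) (hU : U ⊆ (D₁ ∪ D₂).powerset) (hUup : ∀ S ∈ U, ∀ T ∈ (D₁ ∪ D₂).powerset, S ⊆ T → T ∈ U)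
    (hV : V ⊆ (D₁ ∪ D₂).powerset) (hVup : ∀ S ∈ V, ∀ T ∈ (D₁ ∪ D₂).powerset, S ⊆ T → T ∈ V) :
    (0 : ℝ) ≤ f3sum ℝ D₁ D₂ θ (fun S => if S ∈ U then 1 else 0) (fun S => if S ∈ V then 1 else 0) := by
  obtain ⟨β, hinj, h1, h2⟩ := exists_relabel D₁ D₂ hdisj
  set D := D₁ ∪ D₂ with hD
  have hDimg : D.image β = Finset.range (D₁.card + D₂.card) := by
    rw [hD, Finset.image_union, h1, h2]
    ext i; simp only [Finset.mem_union, Finset.mem_range, Finset.mem_Ico]; omega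
  -- image on patterns is injective on `P(D)`
  have himg_inj : ∀ S ∈ D.powerset, ∀ T ∈ D.powerset, S.image β = T.image β → S = T := by
    intro S hS T hT hST
    rw [← filter_mem_image_eq hinj (Finset.mem_powerset.1 hS), hST, filter_mem_image_eq hinj (Finset.mem_powerset.1 hT)]
  -- pushed-forward families
  let U' := U.image (fun S => S.image β)
  let V' := V.image (fun S => S.image β)
  have hind : ∀ (W : Finset (Finset ι)), W ⊆ D.powerset → ∀ S ∈ D.powerset,
      (if S ∈ W then (1 : ℝ) else 0) = (if S.image β ∈ W.image (fun S => S.image β) then (1 : ℝ) else 0) := by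
    intro W hW S hS
    have : S ∈ W ↔ S.image β ∈ W.image (fun S => S.image β) := by
      constructor
      · exact fun h => Finset.mem_image_of_mem _ h
      · intro h
        obtain ⟨T, hT, hTS⟩ := Finset.mem_image.1 h
        rwa [← himg_inj T (hW hT) S hS hTS]
    by_cases h : S ∈ W
    · rw [if_pos h, if_pos (this.1 h)]
    · rw [if_neg h, if_neg (fun h' => h (this.2 h'))]
  have hup : ∀ (W : Finset (Finset ι)), W ⊆ D.powerset → (∀ S ∈ W, ∀ T ∈ D.powerset, S ⊆ T → T ∈ W) →
      W.image (fun S => S.image β) ⊆ (Finset.range (D₁.card + D₂.card)).powerset ∧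
      ∀ S' ∈ W.image (fun S => S.image β), ∀ T' ∈ (Finset.range (D₁.card + D₂.card)).powerset, S' ⊆ T' →
        T' ∈ W.image (fun S => S.image β) := by
    intro W hW hWup
    refine ⟨fun S' hS' => ?_, fun S' hS' T' hT' hST => ?_⟩
    · obtain ⟨S, hS, rfl⟩ := Finset.mem_image.1 hS'
      rw [Finset.mem_powerset, ← hDimg]
      exact Finset.image_subset_image (Finset.mem_powerset.1 (hW hS))
    · obtain ⟨S, hS, rfl⟩ := Finset.mem_image.1 hS'
      have hT'D : T' ⊆ D.image β := by rw [hDimg]; exact Finset.mem_powerset.1 hT'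
      set T := D.filter (fun a => β a ∈ T') with hT
      have hTimg : T.image β = T' := image_filter_mem_eq hT'D
      have hTD : T ⊆ D := Finset.filter_subset _ _
      have hSsub : S ⊆ T := fun a ha =>
        Finset.mem_filter.2 ⟨Finset.mem_powerset.1 (hW hS) ha, hST (Finset.mem_image_of_mem β ha)⟩
      have hTW : T ∈ W := hWup S hS T (Finset.mem_powerset.2 hTD) hSsub
      rw [← hTimg]
      exact Finset.mem_image_of_mem _ hTW
  obtain ⟨hU'1, hU'2⟩ := hup U hU hUup
  obtain ⟨hV'1, hV'2⟩ := hup V hV hVup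
  rw [f3sum_congr_left D₁ D₂ θ _ (hind U hU), f3sum_congr_right D₁ D₂ θ _ (hind V hV)]
  rw [f3sum_image (R := ℝ) β hinj θ (fun S => if S ∈ U' then 1 else 0) (fun S => if S ∈ V' then 1 else 0), h1, h2]
  exact hnat U' V' hU'1 hU'2 hV'1 hV'2

end SahiOneStep

end Summit.CriticalPhenomena.PercolationContinuityZ3.Theorems
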